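import Summits.QuantumFields.YangMills.Theorems.BalabanUVNodesPortS1Sect5AtRecordF1Pkg

/-!
# NODE O port, row PT-A-2 — KERNEL WITNESS that the NUMERIC conjuncts of the F1′ rows are JOINTLY SATISFIABLE (the symmetric counterpart of referee ref-H's F1 probe, which certified
# that the gen-3 rows were NOT: `thetaFill` pinned `ν.ε₀ := 1`)

Porter PT-A-2 (`ymgap-nodeO-port-PTA-2`), `--supports stmt-QuantumFields-27930 --as helper`.  The `hrows` of `sect5_recordPlimAx_of_rows₂'` ∕ `sect4_recordTermsAx_of_formatPlusG_rows'` carry, besides the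
[B11] ∕ (F7a) ∕ (F7a-supp) ∕ (I19) rows (NOT numeric, NOT witnessed here — N-lane suppliers), five NUMERIC clauses in the letters `a₀ = θ.ν.εreg = θ.εbg` (at `θ := thetaFill F a₀ ε₂₉`, both `rfl`)
and the free radius `t = νD.ε₀`: the Federbush guard `((d·L)²∕4)·t < δ_Fed`, the [B7] (53) smallness `(143·((d+4)²∕4)²)·a₀ ≤ ⅓` and `2a₀ ≤ 2δ_SU∕((d+4)L)²`, and the nesting `2a₀ ≤ t·L²`.
WHAT IS PROVED (0 sorry, 0 def): `f1Rows_numerics_satisfiable` — for all naturals `d, L ≥ 1` there are `a₀, t > 0` satisfying all of them (witness: `t := δ_Fed ∕ (2·((dL)²∕4 + 1))`,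
`a₀ := min of the three resulting upper bounds`); `thetaFill_εbg_eq` (`rfl` receipt: the background radius IS the letter `a₀`; the [B11] radius receipt `thetaFill_εreg` is PTA-1's, FILE `…PortS1PathLetter`).
HONEST FRAMING.  Elementary real arithmetic; it shows only that no clause of the re-keyed rows is pinned-false; nothing of Bałaban's estimates asserted, ported or discharged; 27930 signed-open
(⁸-Ax-LR4), no claim held; finite 𝕋⁴ at fixed ε — NOT continuum∕OS∕Clay; the Yang–Mills mass gap is NOT proved by any of this. [cite: Balaban1987RG1, (2.3) p.265 (bookkeeping); Balaban1985Averaging, Prop. 2 (53) p.26]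
-/

noncomputable section

namespace Summit.QuantumFields.YangMills.Theorems.BalabanUVNodesPortS1

open Literature.MathematicalPhysics.QuantumFieldTheory.Balaban1983to89
open Literature.MathematicalPhysics.QuantumFieldTheory.Balaban1983to89.Node00
open Literature.MathematicalPhysics.QuantumFieldTheory.Balaban1983to89.ExpMeanLog (deltaSU deltaSU_pos)
open T4Continuum (T4Family)
open Summit.QuantumFields.YangMills.Theorems.K0RecordFormatNames
open FederbushMean (deltaFed deltaFed_pos)

/-- `(thetaFill F a₀ ε₂₉).εbg = a₀` (`rfl`): the background radius IS the letter `a₀`. [cite: Balaban1987RG1, (0.21) p.256 (bookkeeping)] -/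
theorem thetaFill_εbg_eq (F : T4Family) (a₀ ε₂₉ : ℝ) : (thetaFill F a₀ ε₂₉).εbg = a₀ := rfl

/-- **THE NUMERIC CONJUNCTS OF THE F1′ ROWS ARE JOINTLY SATISFIABLE**: for all `d, L ≥ 1` there are `a₀ > 0` (the [B11]∕background radius) and `t > 0` (the free domain radius `νD.ε₀`) with
`((dL)²∕4)·t < δ_Fed`, `(143·((d+4)²∕4)²)·a₀ ≤ ⅓`, `2a₀ ≤ 2δ_SU∕((d+4)L)²`, `2a₀ ≤ t·L²`. [cite: Balaban1985Averaging, Prop. 2 (53) p.26; Balaban1987RG1, (2.3) p.265 (bookkeeping)] -/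
theorem f1Rows_numerics_satisfiable (d L : ℕ) (hd : 1 ≤ d) (hL : 1 ≤ L) :
    ∃ a₀ t : ℝ, 0 < a₀ ∧ 0 < t ∧
      (((d * L : ℕ) : ℝ)) ^ 2 / 4 * t < deltaFed (Fin 2) ∧
      (143 * ((((d + 4 : ℕ) : ℝ)) ^ 2 / 4) ^ 2) * a₀ ≤ 1 / 3 ∧
      2 * a₀ ≤ 2 * deltaSU (Fin 2) / (((d + 4) * L : ℕ) : ℝ) ^ 2 ∧
      2 * a₀ ≤ t * ((L : ℝ)) ^ 2 := by
  have hδF : 0 < deltaFed (Fin 2) := deltaFed_pos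
  have hδS : 0 < deltaSU (Fin 2) := deltaSU_pos
  have hL' : (1 : ℝ) ≤ (L : ℝ) := by exact_mod_cast hL
  set A : ℝ := (((d * L : ℕ) : ℝ)) ^ 2 / 4 with hA
  have hA0 : 0 ≤ A := by rw [hA]; positivity
  set t : ℝ := deltaFed (Fin 2) / (2 * (A + 1)) with ht
  have ht0 : 0 < t := by rw [ht]; positivity
  set c₂ : ℝ := 143 * ((((d + 4 : ℕ) : ℝ)) ^ 2 / 4) ^ 2 with hc₂
  have hc₂0 : 0 < c₂ := by rw [hc₂]; positivity
  set c₃ : ℝ := (((d + 4) * L : ℕ) : ℝ) ^ 2 with hc₃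
  have hc₃0 : 0 < c₃ := by
    rw [hc₃]
    have : (0 : ℝ) < (((d + 4) * L : ℕ) : ℝ) := by exact_mod_cast Nat.mul_pos (by omega) (by omega)
    positivity
  set b₂ : ℝ := 1 / (3 * c₂) with hb₂
  set b₃ : ℝ := deltaSU (Fin 2) / c₃ with hb₃
  set b₄ : ℝ := t * (L : ℝ) ^ 2 / 2 with hb₄
  have hb₂0 : 0 < b₂ := by rw [hb₂]; positivity
  have hb₃0 : 0 < b₃ := by rw [hb₃]; positivity
  have hb₄0 : 0 < b₄ := by rw [hb₄]; positivity
  refine ⟨min (min b₂ b₃) b₄, t, lt_min (lt_min hb₂0 hb₃0) hb₄0, ht0, ?_, ?_, ?_, ?_⟩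
  · -- Federbush: `A·t = δ·A∕(2(A+1)) < δ`
    have h1 : A * t = deltaFed (Fin 2) * (A / (2 * (A + 1))) := by rw [ht]; ring
    have h2 : A / (2 * (A + 1)) < 1 := by
      rw [div_lt_one (by positivity)]; linarith
    calc A * t = deltaFed (Fin 2) * (A / (2 * (A + 1))) := h1
      _ < deltaFed (Fin 2) * 1 := by exact mul_lt_mul_of_pos_left h2 hδF
      _ = deltaFed (Fin 2) := mul_one _
  · have hle : min (min b₂ b₃) b₄ ≤ b₂ := (min_le_left _ _).trans (min_le_left _ _)
    calc c₂ * min (min b₂ b₃) b₄ ≤ c₂ * b₂ := by gcongr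
      _ = 1 / 3 := by rw [hb₂]; field_simp
  · have hle : min (min b₂ b₃) b₄ ≤ b₃ := (min_le_left _ _).trans (min_le_right _ _)
    calc 2 * min (min b₂ b₃) b₄ ≤ 2 * b₃ := by gcongr
      _ = 2 * deltaSU (Fin 2) / c₃ := by rw [hb₃]; ring
  · have hle : min (min b₂ b₃) b₄ ≤ b₄ := min_le_right _ _
    calc 2 * min (min b₂ b₃) b₄ ≤ 2 * b₄ := by gcongr
      _ = t * (L : ℝ) ^ 2 := by rw [hb₄]; ring

end Summit.QuantumFields.YangMills.Theorems.BalabanUVNodesPortS1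

end
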